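import Mathlib
import HarnessLib
import Summits.Ventures.LatticeQCDFlow.Scaling.U1PlaquetteMeanPositive
import Summits.Ventures.LatticeQCDFlow.Scaling.AutoregressiveGaugePlaquetteMarginal

/-!
# LatticeQCDFlow / Scaling — `U(1)` in ANY dimension: the 2×1 (domino) Wilson loop has a strictly positive
# mean, `⟨Re(U_p U_{p+e_k})⟩_β > 0` for `β > 0` (Ginibre); the domino holonomy as a word in six links

HONEST FRAMING: exact (Metropolis-corrected) sampling algorithms for lattice gauge theory;
figures of merit are autocorrelation/cost numbers at stated couplings and volumes; no
continuum-physics claim.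

Venture `LatticeQCDFlow` (cell pub-lqcd), topic `Scaling`, FANOUT row 30 (lean-1, GEN-18) — OUR WORK, the input
that lifts the two-dimensional "reach through the integrated block" of `Scaling/Wilson2DU1DominoDensity` /
`Scaling/AutoregressiveGaugeDominoReads` to EVERY dimension for `U(1)`: torus `(ℤ/L)^d`, `L ≥ 2`, axes `k ≠ l`,
the DOMINO at `x` = plaquettes `(x; k, l)` and `(x + e_k; k, l)` glued along `(x + e_k, l)`.

* §1 `plaquetteHolonomy_mul_shift_dir` — for a commutative group the domino holonomy `hol_x·hol_{x+e_k}` is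
  the word `U_{(x,k)}·[U_{(x+e_k,k)} U_{(x+2e_k,l)} U_{(x+e_k+e_l,k)}⁻¹]·[U_{(x+e_l,k)}⁻¹ U_{(x,l)}⁻¹]` in the
  six boundary links (the shared link cancels); `rectangleHolonomy_two_one_eq_mul` — it is the tree's `2 × 1`
  rectangular Wilson-loop holonomy; `dominoHolonomy_update_first_dir` — redrawing `(x, k)` multiplies it on
  the left; `integral_comp_dominoHolonomy_mul_dir` — hence `∫ H(hol_x hol_{x+e_k})·N = (∫ H dHaar)·∫ N` for
  any bounded measurable factor `N` blind to `U_{(x,k)}` (any compact commutative `G`, any `d`).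
* §2 `wilsonWeight_u1_props` (the `U(1)` Wilson weight is measurable and squeezed between `e^{−2β|P|}` and
  `1`); **`wilson_u1_integral_re_domino_pos`** — `∫ Re(hol_x U · hol_{x+e_k} U) e^{−β S_W(U)} dHaar^{⊗E}(U) > 0`
  for every `d`, `L ≥ 2`, `β > 0`: GINIBRE'S INEQUALITY (tree `ginibreExpect_reChar_mono`, as in
  `Scaling/U1PlaquetteMeanPositive`) for the `2 × 1` loop character `u1RectChar x k l 2 1` brings the coupling
  down to the two plaquettes of the domino, whose holonomies are independent Haar variables under product
  Haar; there the mean is `(∫ Re u e^{βRe u})² / (∫ e^{βRe u})² > 0` (the `Im` part has mean zero by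
  `u ↦ u⁻¹`).

READING (value-free): for `U(1)` lattice gauge theory in any dimension the law of the domino holonomy is NOT
Haar at any `β > 0` — the input for the engine of the sequel (`Scaling/AutoregressiveGaugeDominoReadsAnyDim`:
with the shared link integrated, the closing link reads links it shares no plaquette with).  NOT CLAIMED:
non-abelian groups (no `⟨W_{2×1}⟩ > 0` on the torus in the tree); any number of ours.  Elementary over the
parents; no `def`; nothing is cited as a fact beyond the tree; no `sorry`.
-/

noncomputable section

namespace Summit.Ventures.LatticeQCDFlow.Theory2.Autoregressive

open MeasureTheory Function Set
open Literature.MathematicalPhysics.QuantumFieldTheory Literature.MathematicalPhysics.QuantumLattice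
open Literature.Probability.LatticeModels (ginibreExpect ginibreWeight ginibreHamiltonian reChar
  ginibreExpect_reChar_mono continuous_ginibreWeight integrable_of_continuous_compactSpace)
open Summit.Ventures.LatticeQCDFlow.Exactness
open Summit.Ventures.LatticeQCDFlow.Theory2.Lattice.TwoDim (measurable_circle_re abs_circle_re_le_one)
open Summit.Ventures.LatticeQCDFlow.Theory2.HaarConv (measurable_circle_im')

variable {d L : ℕ}

/-! ## §1 The domino holonomy in any dimension -/

/-- **The domino holonomy as a word in the six boundary links** (commutative `G`, any `d`): the shared link
`(x + e_k, l)` cancels between `hol_x` and `hol_{x+e_k}`. [ours] -/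
theorem plaquetteHolonomy_mul_shift_dir {G : Type*} [CommGroup G] (U : GaugeConfig d L G) (x : Site d L)
    (k l : Fin d) :
    plaquetteHolonomy U x k l * plaquetteHolonomy U (x.shift k) k l =
      U (x, k) * ((U (x.shift k, k) * U ((x.shift k).shift k, l) * (U ((x.shift k).shift l, k))⁻¹) *
        ((U (x.shift l, k))⁻¹ * (U (x, l))⁻¹)) := by
  have h1 : plaquetteHolonomy U x k l =
      (U (x, k) * ((U (x.shift l, k))⁻¹ * (U (x, l))⁻¹)) * U (x.shift k, l) := by
    simp only [plaquetteHolonomy]; ac_rfl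
  have h2 : plaquetteHolonomy U (x.shift k) k l =
      (U (x.shift k, l))⁻¹ *
        (U (x.shift k, k) * U ((x.shift k).shift k, l) * (U ((x.shift k).shift l, k))⁻¹) := by
    simp only [plaquetteHolonomy]; ac_rfl
  rw [h1, h2, mul_assoc, mul_inv_cancel_left]
  ac_rfl

/-- **The domino holonomy is the `2 × 1` rectangular Wilson-loop holonomy** (commutative `G`). [ours] -/
theorem rectangleHolonomy_two_one_eq_mul {G : Type*} [CommGroup G] (U : GaugeConfig d L G) (x : Site d L)
    (k l : Fin d) :
    rectangleHolonomy U x k l 2 1 = plaquetteHolonomy U x k l * plaquetteHolonomy U (x.shift k) k l := by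
  have h2 : x + Pi.single k ((2 : ℕ) : ZMod L) = (x.shift k).shift k := by
    rw [Site.shift, Site.shift, add_assoc, ← Pi.single_add]; norm_num
  have h1 : ∀ y : Site d L, y + Pi.single l ((1 : ℕ) : ZMod L) = y.shift l := fun y => by
    rw [Site.shift, Nat.cast_one]
  have hc : (x.shift l).shift k = (x.shift k).shift l := by
    simp only [Site.shift]; exact add_right_comm _ _ _
  rw [plaquetteHolonomy_mul_shift_dir]
  simp only [rectangleHolonomy, lineHolonomy, h2, h1, hc, mul_one, mul_inv_rev]
  simp only [mul_comm, mul_assoc, mul_left_comm]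

/-- Redrawing the first link `(x, k)` multiplies the domino holonomy on the left (the five other boundary
links are different links; `k ≠ l`, `L ≥ 2`). [ours] -/
theorem dominoHolonomy_update_first_dir {G : Type*} [CommGroup G] (hL : 2 ≤ L) (U : GaugeConfig d L G)
    (x : Site d L) {k l : Fin d} (hkl : k ≠ l) (v : G) :
    plaquetteHolonomy (update U (x, k) v) x k l * plaquetteHolonomy (update U (x, k) v) (x.shift k) k l =
      v * ((U (x.shift k, k) * U ((x.shift k).shift k, l) * (U ((x.shift k).shift l, k))⁻¹) *
        ((U (x.shift l, k))⁻¹ * (U (x, l))⁻¹)) := by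
  have hek : ∀ z : Site d L, z.shift k ≠ z := fun z =>
    Summit.Ventures.LatticeQCDFlow.Theory2.Autoregressive.site_shift_ne hL z k
  have hel : ∀ z : Site d L, z.shift l ≠ z := fun z => site_shift_ne hL z l
  have hekl : (x.shift k).shift l ≠ x := by
    intro h
    apply single_add_single_ne_zero_of_ne hL hkl
    have h' : x + (Pi.single k 1 + Pi.single l 1) = x + 0 := by
      rw [add_zero, ← add_assoc]; exact h
    exact add_left_cancel h'
  have n1 : ((x.shift k, k) : Edge d L) ≠ (x, k) := fun h => hek x (congrArg Prod.fst h)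
  have n2 : (((x.shift k).shift k, l) : Edge d L) ≠ (x, k) := fun h => hkl (congrArg Prod.snd h).symm
  have n3 : (((x.shift k).shift l, k) : Edge d L) ≠ (x, k) := fun h => hekl (congrArg Prod.fst h)
  have n4 : ((x.shift l, k) : Edge d L) ≠ (x, k) := fun h => hel x (congrArg Prod.fst h)
  have n5 : ((x, l) : Edge d L) ≠ (x, k) := fun h => hkl (congrArg Prod.snd h).symm
  rw [plaquetteHolonomy_mul_shift_dir, update_self, update_of_ne n1, update_of_ne n2, update_of_ne n3,
    update_of_ne n4, update_of_ne n5]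

/-- **Redrawing the first link makes the domino holonomy Haar, independently of any factor blind to that
link**: `∫ H(hol_x U · hol_{x+e_k} U)·N(U) dHaar^{⊗E}(U) = (∫ H dHaar)·∫ N dHaar^{⊗E}` for bounded measurable
`H`, `N` with `N(U[(x,k) ↦ v]) = N(U)` (any compact commutative `G`, `k ≠ l`, `L ≥ 2`). [ours] -/
theorem integral_comp_dominoHolonomy_mul_dir {G : Type*} [CommGroup G] [TopologicalSpace G]
    [IsTopologicalGroup G] [CompactSpace G] [SecondCountableTopology G] [MeasurableSpace G] [BorelSpace G]
    [NeZero L] (hL : 2 ≤ L) (x : Site d L) {k l : Fin d} (hkl : k ≠ l) {H : G → ℝ} (hHm : Measurable H)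
    {C : ℝ} (hHb : ∀ g, |H g| ≤ C) {N : GaugeConfig d L G → ℝ} (hNm : Measurable N) {C' : ℝ}
    (hNb : ∀ U, |N U| ≤ C') (hN : ∀ U v, N (update U (x, k) v) = N U) :
    ∫ U, H (plaquetteHolonomy U x k l * plaquetteHolonomy U (x.shift k) k l) * N U
        ∂Measure.pi (fun _ : Edge d L => haarProbability G) =
      (∫ g, H g ∂(haarProbability G)) * ∫ U, N U ∂Measure.pi (fun _ : Edge d L => haarProbability G) := by
  set μ := haarProbability G with hμ
  have huniv : (fun _ : Edge d L => μ) (x, k) Set.univ ≠ 0 := by simp [hμ]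
  have hhm : Measurable fun U : GaugeConfig d L G =>
      plaquetteHolonomy U x k l * plaquetteHolonomy U (x.shift k) k l :=
    (measurable_plaquetteHolonomy x k l).mul (measurable_plaquetteHolonomy (x.shift k) k l)
  have hFm : Measurable fun U : GaugeConfig d L G =>
      H (plaquetteHolonomy U x k l * plaquetteHolonomy U (x.shift k) k l) * N U :=
    (hHm.comp hhm).mul hNm
  have hC : 0 ≤ C := (abs_nonneg _).trans (hHb 1)
  have hFi : Integrable (fun U : GaugeConfig d L G =>
      H (plaquetteHolonomy U x k l * plaquetteHolonomy U (x.shift k) k l) * N U)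
      (Measure.pi fun _ : Edge d L => μ) :=
    Integrable.mono' (integrable_const (C * C')) hFm.aestronglyMeasurable
      (ae_of_all _ fun U => by
        rw [Real.norm_eq_abs, abs_mul]
        exact mul_le_mul (hHb _) (hNb _) (abs_nonneg _) hC)
  rw [integral_pi_eq_integral_integral_update' (fun _ : Edge d L => μ) (x, k) huniv hFi]
  simp only [measure_univ, inv_one, ENNReal.toReal_one, one_smul]
  have hinner : ∀ U : GaugeConfig d L G,
      ∫ v, H (plaquetteHolonomy (update U (x, k) v) x k l *
          plaquetteHolonomy (update U (x, k) v) (x.shift k) k l) * N (update U (x, k) v) ∂μ =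
        (∫ g, H g ∂μ) * N U := by
    intro U
    simp only [dominoHolonomy_update_first_dir hL U x hkl, hN]
    rw [integral_mul_const]
    congr 1
    exact integral_mul_right_eq_self H _
  simp_rw [hinner]
  rw [integral_const_mul]

/-! ## §2 The domino mean is positive (Ginibre) -/

variable [NeZero L]

/-- The `U(1)` Wilson weight on `(ℤ/L)^d` is measurable, at most one (`β ≥ 0`) and at least
`e^{−2β|P|}`. [ours] -/
theorem wilsonWeight_u1_props {β : ℝ} (hβ : 0 ≤ β) :
    Measurable (fun U : GaugeConfig d L Circle => Real.exp (-β * wilsonAction u1Rep U)) ∧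
      (∀ U : GaugeConfig d L Circle, |Real.exp (-β * wilsonAction u1Rep U)| ≤ 1) ∧
      ∀ U : GaugeConfig d L Circle,
        Real.exp (-(2 * β * Fintype.card (Plaquette d L))) ≤ Real.exp (-β * wilsonAction u1Rep U) := by
  have hterm : ∀ (U : GaugeConfig d L Circle) (q : Plaquette d L),
      0 ≤ ((1 : ℕ) : ℝ) - (u1Rep (plaquetteHolonomy U q.1 q.2.1.1 q.2.1.2)).trace.re ∧
        ((1 : ℕ) : ℝ) - (u1Rep (plaquetteHolonomy U q.1 q.2.1.1 q.2.1.2)).trace.re ≤ 2 := by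
    intro U q
    rw [trace_u1Rep_re, Nat.cast_one]
    have h := abs_le.1 (abs_circle_re_le_one (plaquetteHolonomy U q.1 q.2.1.1 q.2.1.2))
    constructor <;> linarith [h.1, h.2]
  have hS0 : ∀ U : GaugeConfig d L Circle, 0 ≤ wilsonAction u1Rep U := fun U =>
    Finset.sum_nonneg fun q _ => (hterm U q).1
  have hS2 : ∀ U : GaugeConfig d L Circle, wilsonAction u1Rep U ≤ 2 * Fintype.card (Plaquette d L) := by
    intro U
    calc wilsonAction u1Rep U ≤ ∑ _q : Plaquette d L, (2 : ℝ) := Finset.sum_le_sum fun q _ => (hterm U q).2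
      _ = 2 * Fintype.card (Plaquette d L) := by
        rw [Finset.sum_const, Finset.card_univ, nsmul_eq_mul, mul_comm]
  refine ⟨Real.measurable_exp.comp ((measurable_wilsonAction u1Rep continuous_u1Rep).const_mul _),
    fun U => ?_, fun U => ?_⟩
  · rw [abs_of_pos (Real.exp_pos _), Real.exp_le_one_iff]
    have := hS0 U; nlinarith
  · refine Real.exp_le_exp.2 ?_
    have := hS2 U; nlinarith

/-- `∫ Im u · e^{β Re u} dHaar(u) = 0` on `U(1)` (inversion `u ↦ u⁻¹` preserves Haar, fixes `Re` and
flips `Im`). [ours] -/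
theorem integral_im_mul_exp_mul_re_eq_zero (β : ℝ) :
    ∫ u : Circle, ((u : Circle) : ℂ).im * Real.exp (β * ((u : Circle) : ℂ).re) ∂(haarProbability Circle) = 0 := by
  have h := integral_inv_eq_self
    (fun u : Circle => ((u : Circle) : ℂ).im * Real.exp (β * ((u : Circle) : ℂ).re)) (haarProbability Circle)
  have hre : ∀ u : Circle, (((u⁻¹ : Circle)) : ℂ).re = ((u : Circle) : ℂ).re := fun u => by
    rw [Circle.coe_inv_eq_conj, Complex.conj_re]
  have him : ∀ u : Circle, (((u⁻¹ : Circle)) : ℂ).im = -((u : Circle) : ℂ).im := fun u => by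
    rw [Circle.coe_inv_eq_conj, Complex.conj_im]
  simp only [hre, him, neg_mul, integral_neg] at h
  linarith

/-- **`∫ Re(hol_x U · hol_{x+e_k} U) e^{−βS_W(U)} dHaar^{⊗E}(U) > 0`** — THE `2 × 1` WILSON LOOP OF `U(1)` HAS A
STRICTLY POSITIVE MEAN in every dimension `d`, every volume `L ≥ 2`, at every `β > 0`, for every `x` and
axes `k < l` (Ginibre's inequality down to the two-plaquette theory, where the two holonomies are independent
Haar variables). [ours] -/
theorem wilson_u1_integral_re_domino_pos (hL : 2 ≤ L) {β : ℝ} (hβ : 0 < β) (x : Site d L) {k l : Fin d}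
    (hkl : k < l) :
    0 < ∫ U : GaugeConfig d L Circle,
        ((plaquetteHolonomy U x k l * plaquetteHolonomy U (x.shift k) k l : Circle) : ℂ).re *
          Real.exp (-β * wilsonAction u1Rep U) ∂Measure.pi (fun _ : Edge d L => haarProbability Circle) := by
  classical
  have hkl' : k ≠ l := ne_of_lt hkl
  set μ := Measure.pi (fun _ : Edge d L => haarProbability Circle) with hμ
  set χ : Plaquette d L → (GaugeConfig d L Circle →ₜ* Circle) :=
    fun q => u1PlaqChar q.1 q.2.1.1 q.2.1.2 with hχ
  set p₁ : Plaquette d L := (x, ⟨(k, l), hkl⟩) with hp₁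
  set p₂ : Plaquette d L := (x.shift k, ⟨(k, l), hkl⟩) with hp₂
  have hp12 : p₁ ≠ p₂ := fun h =>
    (Summit.Ventures.LatticeQCDFlow.Theory2.Autoregressive.site_shift_ne hL x k) (congrArg Prod.fst h).symm
  set J₀ : Plaquette d L → ℝ := fun q => if q = p₁ ∨ q = p₂ then β else 0 with hJ₀
  set χ₀ : GaugeConfig d L Circle →ₜ* Circle := u1RectChar x k l 2 1 with hχ₀
  have hχ₀ : ∀ U : GaugeConfig d L Circle,
      reChar χ₀ U = ((plaquetteHolonomy U x k l * plaquetteHolonomy U (x.shift k) k l : Circle) : ℂ).re := by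
    intro U
    simp only [reChar, hχ₀, u1RectChar_apply, rectangleHolonomy_two_one_eq_mul]
  -- Ginibre: the two-plaquette expectation is below the full one
  have hmono : ginibreExpect μ χ J₀ (reChar χ₀) ≤ ginibreExpect μ χ (fun _ => β) (reChar χ₀) :=
    ginibreExpect_reChar_mono μ (fun θ => exists_mul_self_eq_u1Config θ) χ χ₀
      (fun q => by simp only [hJ₀]; split_ifs <;> [exact hβ.le; exact le_rfl])
      (fun q => by simp only [hJ₀]; split_ifs <;> [exact le_rfl; exact hβ.le])
  -- one-variable integrals
  set re : Circle → ℝ := fun u => ((u : Circle) : ℂ).re with hre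
  set im : Circle → ℝ := fun u => ((u : Circle) : ℂ).im with him
  have hrm : Measurable re := measurable_circle_re
  have himm : Measurable im := measurable_circle_im'
  set E : Circle → ℝ := fun u => Real.exp (β * re u) with hE
  have hEm : Measurable E := Real.measurable_exp.comp (hrm.const_mul β)
  have hEb : ∀ u, |E u| ≤ Real.exp |β| := fun u => by
    simp only [hE, abs_of_pos (Real.exp_pos _)]
    refine Real.exp_le_exp.2 ?_
    calc β * re u ≤ |β * re u| := le_abs_self _
      _ = |β| * |re u| := abs_mul _ _
      _ ≤ |β| * 1 := mul_le_mul_of_nonneg_left (abs_circle_re_le_one u) (abs_nonneg _)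
      _ = |β| := mul_one _
  have hreb : ∀ u, |re u| ≤ 1 := fun u => abs_circle_re_le_one u
  have himb : ∀ u, |im u| ≤ 1 := fun u => by
    simp only [him]; have := Complex.abs_im_le_norm ((u : Circle) : ℂ); rwa [Circle.norm_coe] at this
  set nβ := ∫ u, re u * E u ∂(haarProbability Circle) with hnβ
  set dβ := ∫ u, E u ∂(haarProbability Circle) with hdβ
  have hnpos : 0 < nβ := integral_re_mul_exp_mul_re_pos hβ
  have hdpos : 0 < dβ := integral_exp_mul_re_pos β
  have hi0 : ∫ u, im u * E u ∂(haarProbability Circle) = 0 := integral_im_mul_exp_mul_re_eq_zero β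
  -- the two-plaquette Hamiltonian and weight
  have hHam : ∀ U : GaugeConfig d L Circle, ginibreHamiltonian χ J₀ U =
      β * re (plaquetteHolonomy U x k l) + β * re (plaquetteHolonomy U (x.shift k) k l) := by
    intro U
    simp only [ginibreHamiltonian, reChar, hχ, u1PlaqChar_apply, hJ₀, ite_mul, zero_mul]
    rw [Finset.sum_ite, Finset.sum_const_zero, add_zero]
    have hfilt : Finset.univ.filter (fun q : Plaquette d L => q = p₁ ∨ q = p₂) = {p₁, p₂} := by
      ext q; simp [Finset.mem_filter]
    rw [hfilt, Finset.sum_pair hp12]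
  have hW : ∀ U : GaugeConfig d L Circle, ginibreWeight χ J₀ U =
      E (plaquetteHolonomy U x k l) * E (plaquetteHolonomy U (x.shift k) k l) := by
    intro U; rw [ginibreWeight, hHam, Real.exp_add]
  -- independence of the two holonomies under product Haar: product integrands factorise
  have hek : ((x.shift k, k) : Edge d L) ≠ (x, k) := fun h =>
    (Summit.Ventures.LatticeQCDFlow.Theory2.Autoregressive.site_shift_ne hL x k) (congrArg Prod.fst h)
  have hekl : (x.shift k).shift l ≠ x := by
    intro h
    apply single_add_single_ne_zero_of_ne hL hkl'
    have h' : x + (Pi.single k 1 + Pi.single l 1) = x + 0 := by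
      rw [add_zero, ← add_assoc]; exact h
    exact add_left_cancel h'
  have hhol2 : ∀ (U : GaugeConfig d L Circle) (v : Circle),
      plaquetteHolonomy (update U (x, k) v) (x.shift k) k l = plaquetteHolonomy U (x.shift k) k l := by
    intro U v
    have n2 : (((x.shift k).shift k, l) : Edge d L) ≠ (x, k) := fun h => hkl' (congrArg Prod.snd h).symm
    have n3 : (((x.shift k).shift l, k) : Edge d L) ≠ (x, k) := fun h => hekl (congrArg Prod.fst h)
    have n4 : ((x.shift k, l) : Edge d L) ≠ (x, k) := fun h => hkl' (congrArg Prod.snd h).symm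
    simp only [plaquetteHolonomy, update_of_ne hek, update_of_ne n2, update_of_ne n3, update_of_ne n4]
  have hfac : ∀ {A B : Circle → ℝ}, Measurable A → Measurable B → (∀ u, |A u| ≤ Real.exp |β|) →
      (∀ u, |B u| ≤ Real.exp |β|) →
      ∫ U, A (plaquetteHolonomy U x k l) * B (plaquetteHolonomy U (x.shift k) k l) ∂μ =
        (∫ u, A u ∂(haarProbability Circle)) * ∫ u, B u ∂(haarProbability Circle) := by
    intro A B hAm hBm hAb hBb
    have huniv : (fun _ : Edge d L => haarProbability Circle) (x, k) Set.univ ≠ 0 := by simp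
    have hFm : Measurable fun U : GaugeConfig d L Circle =>
        A (plaquetteHolonomy U x k l) * B (plaquetteHolonomy U (x.shift k) k l) :=
      (hAm.comp (measurable_plaquetteHolonomy x k l)).mul (hBm.comp (measurable_plaquetteHolonomy _ k l))
    have hFi : Integrable (fun U : GaugeConfig d L Circle =>
        A (plaquetteHolonomy U x k l) * B (plaquetteHolonomy U (x.shift k) k l)) μ :=
      Integrable.mono' (integrable_const (Real.exp |β| * Real.exp |β|)) hFm.aestronglyMeasurable
        (ae_of_all _ fun U => by
          rw [Real.norm_eq_abs, abs_mul]
          exact mul_le_mul (hAb _) (hBb _) (abs_nonneg _) (Real.exp_pos _).le)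
    rw [hμ, integral_pi_eq_integral_integral_update' (fun _ : Edge d L => haarProbability Circle) (x, k)
      huniv hFi]
    simp only [measure_univ, inv_one, ENNReal.toReal_one, one_smul]
    have hinner : ∀ U : GaugeConfig d L Circle,
        ∫ v, A (plaquetteHolonomy (update U (x, k) v) x k l) *
            B (plaquetteHolonomy (update U (x, k) v) (x.shift k) k l) ∂(haarProbability Circle) =
          (∫ u, A u ∂(haarProbability Circle)) * B (plaquetteHolonomy U (x.shift k) k l) := by
      intro U
      simp only [plaquetteHolonomy_update_first hL U x hkl', hhol2]
      rw [integral_mul_const]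
      congr 1
      exact integral_mul_right_eq_self A _
    simp_rw [hinner]
    rw [integral_const_mul, integral_comp_plaquetteHolonomy hL (x.shift k) hkl' hBm hBb]
  -- the single-domino Ginibre expectation: numerator `n² − 0²`, denominator `d²`
  have hnum : ∫ U, reChar χ₀ U * ginibreWeight χ J₀ U ∂μ = nβ * nβ - 0 * 0 := by
    have hpt : ∀ U : GaugeConfig d L Circle, reChar χ₀ U * ginibreWeight χ J₀ U =
        (re (plaquetteHolonomy U x k l) * E (plaquetteHolonomy U x k l)) *
            (re (plaquetteHolonomy U (x.shift k) k l) * E (plaquetteHolonomy U (x.shift k) k l)) -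
          (im (plaquetteHolonomy U x k l) * E (plaquetteHolonomy U x k l)) *
            (im (plaquetteHolonomy U (x.shift k) k l) * E (plaquetteHolonomy U (x.shift k) k l)) := by
      intro U
      rw [hχ₀ U, hW U, Circle.coe_mul, Complex.mul_re]
      simp only [hre, him]
      ring
    have hb1 : ∀ u, |re u * E u| ≤ Real.exp |β| := fun u => by
      rw [abs_mul]
      calc |re u| * |E u| ≤ 1 * Real.exp |β| := mul_le_mul (hreb u) (hEb u) (abs_nonneg _) zero_le_one
        _ = Real.exp |β| := one_mul _
    have hb2 : ∀ u, |im u * E u| ≤ Real.exp |β| := fun u => by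
      rw [abs_mul]
      calc |im u| * |E u| ≤ 1 * Real.exp |β| := mul_le_mul (himb u) (hEb u) (abs_nonneg _) zero_le_one
        _ = Real.exp |β| := one_mul _
    have hi1 : Integrable (fun U : GaugeConfig d L Circle =>
        (re (plaquetteHolonomy U x k l) * E (plaquetteHolonomy U x k l)) *
          (re (plaquetteHolonomy U (x.shift k) k l) * E (plaquetteHolonomy U (x.shift k) k l))) μ :=
      Integrable.mono' (integrable_const (Real.exp |β| * Real.exp |β|))
        ((((hrm.mul hEm).comp (measurable_plaquetteHolonomy x k l)).mul
          ((hrm.mul hEm).comp (measurable_plaquetteHolonomy _ k l))).aestronglyMeasurable)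
        (ae_of_all _ fun U => by
          rw [Real.norm_eq_abs, abs_mul]
          exact mul_le_mul (hb1 _) (hb1 _) (abs_nonneg _) (Real.exp_pos _).le)
    have hi2 : Integrable (fun U : GaugeConfig d L Circle =>
        (im (plaquetteHolonomy U x k l) * E (plaquetteHolonomy U x k l)) *
          (im (plaquetteHolonomy U (x.shift k) k l) * E (plaquetteHolonomy U (x.shift k) k l))) μ :=
      Integrable.mono' (integrable_const (Real.exp |β| * Real.exp |β|))
        ((((himm.mul hEm).comp (measurable_plaquetteHolonomy x k l)).mul
          ((himm.mul hEm).comp (measurable_plaquetteHolonomy _ k l))).aestronglyMeasurable)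
        (ae_of_all _ fun U => by
          rw [Real.norm_eq_abs, abs_mul]
          exact mul_le_mul (hb2 _) (hb2 _) (abs_nonneg _) (Real.exp_pos _).le)
    simp_rw [hpt]
    have e1 := hfac (A := fun u => re u * E u) (B := fun u => re u * E u) (hrm.mul hEm) (hrm.mul hEm) hb1 hb1
    have e2 := hfac (A := fun u => im u * E u) (B := fun u => im u * E u) (himm.mul hEm) (himm.mul hEm)
      hb2 hb2
    beta_reduce at e1 e2
    rw [integral_sub hi1 hi2, e1, e2, hi0]
  have hden : ∫ U, ginibreWeight χ J₀ U ∂μ = dβ * dβ := by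
    simp_rw [hW]
    have e3 := hfac (A := E) (B := E) hEm hEm hEb hEb
    exact e3
  have hsingle : 0 < ginibreExpect μ χ J₀ (reChar χ₀) := by
    rw [ginibreExpect, hnum, hden]
    have : 0 < nβ * nβ - 0 * 0 := by nlinarith
    exact div_pos this (mul_pos hdpos hdpos)
  have hfull : 0 < ginibreExpect μ χ (fun _ => β) (reChar χ₀) := lt_of_lt_of_le hsingle hmono
  -- unfold the full expectation: a positive ratio with a positive denominator
  have hwc : Continuous (ginibreWeight χ fun _ => β) := continuous_ginibreWeight χ _
  have hZ : 0 < ∫ U, ginibreWeight χ (fun _ => β) U ∂μ :=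
    integral_exp_pos (integrable_of_continuous_compactSpace μ hwc)
  have hnumfull : 0 < ∫ U, reChar χ₀ U * ginibreWeight χ (fun _ => β) U ∂μ := by
    have h := hfull
    unfold ginibreExpect at h
    exact (div_pos_iff.1 h).elim (fun h' => h'.1) fun h' => absurd h'.2 (not_lt.2 hZ.le)
  -- back to the Wilson weight
  have hrw : ∀ U : GaugeConfig d L Circle,
      ((plaquetteHolonomy U x k l * plaquetteHolonomy U (x.shift k) k l : Circle) : ℂ).re *
          Real.exp (-β * wilsonAction u1Rep U) =
        Real.exp (-β * Fintype.card (Plaquette d L)) * (reChar χ₀ U * ginibreWeight χ (fun _ => β) U) := by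
    intro U
    rw [exp_neg_mul_wilsonAction_u1_eq_ginibreWeight, hχ₀ U]
    ring
  simp_rw [hrw]
  rw [integral_const_mul]
  exact mul_pos (Real.exp_pos _) hnumfull


end Summit.Ventures.LatticeQCDFlow.Theory2.Autoregressive

end
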